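import Mathlib
import Literature.Computability.AlgebraicComplexity.MatrixMultiplicationExponent
import Literature.Computability.AlgebraicComplexity.BCGPUInfiniteGroups
import HarnessLib

/-!
# BCGPU 2024, Corollary 2.8: the separating-degree price in `GL_n(ℂ)` (statement only)

Topic `Literature/Computability/AlgebraicComplexity` (family `MatrixMultiplication`). Sibling of
`BCGPUInfiniteGroups.lean` (Def. 2.1 `IsSeparatingFamily`, Thm. 2.2 and its corrected, PROVED form
`BCGPU2024_thm_2_2_corrected_holds` in `BCGPUInfiniteGroupsProofs.lean`). This file vendors the
`GL_n(ℂ)` specialisation the authors actually use to price constructions — J. Blasiak, H. Cohn,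
J. A. Grochow, K. Pratt, C. Umans, *Finite matrix multiplication algorithms from infinite
groups*, arXiv:2410.14905 (ITCS 2025), **Corollary 2.8** (held text p. 15, L25–35):

"Suppose `X, Y, Z ⊆ GL_n(ℂ)` (or `U_n`) satisfy the TPP, and there is a set of separating
polynomials for `(X, Y, Z)` of degree at most `s`. Then `ω` satisfies
`(|X| |Y| |Z|)^{ω/3} ≤ s^{\binom{n}{2}(ω−2)} · \binom{s+n²}{n²}`. In particular, if
`|X|, |Y|, |Z| ≥ s^{(1−o_s(1))(n²/2−o_n(n))}`, then `ω = 2`. The same holds if `X, Y, Z` are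
1-parameter families that satisfy the TPP and we replace separating polynomials with
border-separating polynomials."

Its printed proof (p. 15, L44–50): the polynomials of degree `≤ s` in the entries of a matrix in
`GL_n` have dimension `\binom{s+n²}{n²}` and the entries of `Irr_i`, `i ≤ s`, are a basis
[DRS74, dCEP80]; apply Thm. 2.2 (Thm. 2.6 in the border case) with `R_sep = ⋃_{i ≤ s} Irr_i(GL_n)`
and the dimension bound of Lemma 2.7 (`dim ρ ≤ s^{\binom{n}{2}}` for `ρ ∈ Irr_s(GL_n)`, `n ≥ 3`,
`s ≥ 2`, p. 15 L18).

## Lean rendering (`BCGPU2024_cor_2_8`)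

* group `GL_n(ℂ) = Matrix.GeneralLinearGroup (Fin n) ℂ`; the hypotheses `n ≥ 3`, `s ≥ 2` of
  Lemma 2.7 are carried explicitly (the corollary silently needs them through that lemma);
* TPP in the EMBEDDING form `x y⁻¹ y' z⁻¹ = x' z'⁻¹ ⟹ x = x' ∧ y = y' ∧ z = z'` — the form the
  printed proofs use (eq. (2.1)) and the tree's corrected Thm. 2.2 takes (the right-quotient form
  of the paper's §1 makes Thm. 2.2 false, `BCGPU2024_thm_2_2_false`); it is also verbatim the form
  of the `MatrixMultiplication/GLnSeparatingDesigns` route items;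
* "a set of separating polynomials of degree at most `s`" = a separating family in the sense of
  Def. 2.1 (`IsSeparatingFamily`, tree) each of whose members `f x z`, `x ∈ X`, `z ∈ Z`, is the
  evaluation of a polynomial of total degree `≤ s` in the `n²` matrix entries (holomorphic
  polynomials in the complex entries, p. 18 fn. 3 — `MvPolynomial (Fin n × Fin n) ℂ`);
* conclusion with `ω = omega ℂ` (tree), real powers, and `\binom{n}{2} = n(n−1)/2` written out.

What this grounds: the route crux
`Summit.MatrixMultiplication.MatrixMultiplication.Theses.GLnSeparatingDesigns.SeparationDegreeCost`
renders the corollary's BORDER clause for "η-approximate" separators (for every `η > 0` some TPP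
design of the given sizes whose separators are within `η` of the indicator) — a hypothesis that is
neither Def. 2.1 (exact) nor the printed Def. 2.5 (analytic 1-parameter families with `O(ε)`
errors), hence NOT this fact; the exact specialisation of that crux (η-independent designs with
exact separators) is exactly `BCGPU2024_cor_2_8`. NOT vendored here: the border clause / Thm. 2.6
(needs analytic families `(0, α) → GL_n(ℂ)` and border rank), Lemma 2.7 and the [DRS74] basis
theorem as separate facts (Mathlib has no polynomial representation theory of `GL_n`), the
"In particular" asymptotics (pure bookkeeping, done natively by the route's deciding theorem), and
the `U_n` variant.

## References

* [BlasiakCohnGrochowPrattUmans2024] arXiv:2410.14905 — Def. 2.1 (p. 10), Thm. 2.2 (p. 11),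
  Def. 2.5 (p. 13), Thm. 2.6 (p. 14), Lemma 2.7 and Cor. 2.8 (p. 15).
* [DRS74] P. Doubilet, G.-C. Rota, J. Stein, Stud. Appl. Math. 53 (1974) 185–216; [dCEP80]
  C. De Concini, D. Eisenbud, C. Procesi, Invent. Math. 56 (1980) 129–165 (straightening / basis
  of matrix coefficients), as cited on p. 15.
-/

noncomputable section

open scoped BigOperators

namespace Literature.Computability.AlgebraicComplexity

/-- NAMED FACT — **BCGPU 2024, Corollary 2.8** (arXiv:2410.14905, p. 15): "Suppose
`X, Y, Z ⊆ GL_n(ℂ)` satisfy the TPP, and there is a set of separating polynomials for `(X, Y, Z)`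
of degree at most `s`. Then `(|X||Y||Z|)^{ω/3} ≤ s^{\binom n2 (ω−2)} · \binom{s+n²}{n²}`."
Rendering: `n ≥ 3`, `s ≥ 2` (the range of Lemma 2.7 used in the proof); TPP in embedding form
(as in the tree's PROVED `BCGPU2024_thm_2_2_corrected`, not the refuted right-quotient reading);
separating family per Def. 2.1 (`IsSeparatingFamily`) whose members are evaluations of
polynomials of total degree `≤ s` in the matrix entries; `ω = omega ℂ`. The border-separating
clause of the corollary (Thm. 2.6, analytic 1-parameter families) is NOT part of this fact.
Grounds the exact specialisation of
`Summit.MatrixMultiplication.MatrixMultiplication.Theses.GLnSeparatingDesigns.SeparationDegreeCost`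
(whose η-approximate hypothesis is weaker than Def. 2.1, so the item is STRONGER than this print).
[cite: BlasiakCohnGrochowPrattUmans2024, Cor. 2.8 (with Lemma 2.7, Thm. 2.2)] -/
def BCGPU2024_cor_2_8 : Prop :=
  ∀ n : ℕ, 3 ≤ n → ∀ s : ℕ, 2 ≤ s →
    ∀ X Y Z : Finset (Matrix.GeneralLinearGroup (Fin n) ℂ),
      (∀ x ∈ X, ∀ x' ∈ X, ∀ y ∈ Y, ∀ y' ∈ Y, ∀ z ∈ Z, ∀ z' ∈ Z,
        x * y⁻¹ * y' * z⁻¹ = x' * z'⁻¹ → x = x' ∧ y = y' ∧ z = z') →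
      (∃ f : Matrix.GeneralLinearGroup (Fin n) ℂ → Matrix.GeneralLinearGroup (Fin n) ℂ →
          (Matrix.GeneralLinearGroup (Fin n) ℂ → ℂ),
        IsSeparatingFamily X Y Z f ∧
        ∀ x ∈ X, ∀ z ∈ Z, ∃ p : MvPolynomial (Fin n × Fin n) ℂ, p.totalDegree ≤ s ∧
          ∀ g : Matrix.GeneralLinearGroup (Fin n) ℂ,
            f x z g = MvPolynomial.eval
              (fun ij : Fin n × Fin n => (g : Matrix (Fin n) (Fin n) ℂ) ij.1 ij.2) p) →
      ((X.card : ℝ) * Y.card * Z.card) ^ (omega ℂ / 3) ≤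
        (s : ℝ) ^ ((n : ℝ) * (n - 1) / 2 * (omega ℂ - 2)) * ((s + n ^ 2).choose (n ^ 2) : ℝ)

end Literature.Computability.AlgebraicComplexity

end
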